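import Summits.HodgeConjecture.HodgeConjecture.Theses.PeriodDeficiency
import Literature.AlgebraicGeometry.HodgeTheory.ComplexConjugationHolds

/-!
# Route PeriodDeficiency — `Assembly` (item stmt-HodgeConjecture-13787): reduction to the support items

The assembly item of route `PeriodDeficiency` is the thesis implication proper,
`Assembly := QbarGenericIsHodgeGeneric → HodgeConjectureQbar → HodgeConjecture` ("HGQ ∧ HC(ℚ̄)
suffice").  Unlike the assemblies of the other Hodge routes it is NOT pure logic over the route's
items: its content is the known but formally XL reduction (spreading out over `ℚ̄`, Hodge-genericity
of the `ℚ̄`-generic modulus ⇒ finite monodromy orbit, Deligne's global invariant cycle theorem on a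
`ℚ̄`-compactification, restriction to the fibre — Charles–Schnell Thm. 11.3.19 / Voisin 2007
Prop. 1.2 shape), which the route files separately as the support items `ClassicalGeometricVHS`
(stmt-HodgeConjecture-11597, construction of the classical Betti–Hodge datum and the geometric VHS
data), `GenericityReduction` (stmt-HodgeConjecture-11598, the reduction itself) and
`HodgeModelsExist` (stmt-HodgeConjecture-2742).

This helper file records, sorry-free and against the route decls BY NAME:

* `periodDeficiency_hodgeModelsExist_proof : HodgeModelsExist` — the third support item is
  ALREADY A THEOREM of the tree (`Literature.AlgebraicGeometry.HodgeTheory.nonempty_hodgeModel_holds`: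
  Serre GAGA §2 + de Rham + the Hodge decomposition of the compact Kähler `X^an`, nothing unproved);
* `periodDeficiency_assembly_of_supports : ClassicalGeometricVHS → GenericityReduction → Assembly`
  — so `Assembly` hinges exactly on the two open support items 11597 and 11598 (one line of logic,
  the planner's `fun hC hG hM h₁ h₂ => hG hC h₁ h₂ hM` with `hM` discharged);
* `periodDeficiency_assembly_of_hodgeConjecture : HodgeConjecture → Assembly` — `Assembly` is a
  consequence of the summit statement itself, hence not refutable short of `¬ HodgeConjecture`
  (recorded for the refuter pool: exotic `BettiHodgeData` / `GeometricVHSData` cannot kill it, they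
  can only make `QbarGenericIsHodgeGeneric` vacuous).

Nothing here closes the item; it is landed `--supports stmt-HodgeConjecture-13787`.
-/

-- `Summit.HodgeConjecture.HodgeConjecture.Theorems` is the mandated namespace (single-conjunct summit:
-- Sub = Summit), which `linter.dupNamespace` flags on every declaration; the lakefile turns the
-- linter off tree-wide (weak option), restated here so stand-alone elaboration is warning-free too.
set_option linter.dupNamespace false

noncomputable section

namespace Summit.HodgeConjecture.HodgeConjecture.Theorems

open Summit.HodgeConjecture.HodgeConjecture.Theses

/-- **Support item `HodgeModelsExist` of route `PeriodDeficiency` (shared item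
stmt-HodgeConjecture-2742), discharged**: every smooth projective complex variety of dimension `n`
has a Hodge model, by the tree theorem `nonempty_hodgeModel_holds` (Serre, GAGA §2 n°5 Prop. 2:
analytification; de Rham's theorem; Voisin (2002) §3.3.2 and §6.1.3 Prop. 6.11: `X^an` is compact
Kähler and carries the Hodge decomposition).  The type is literally the route decl
`Summit.HodgeConjecture.HodgeConjecture.Theses.PeriodDeficiency.HodgeModelsExist`.
[cite: SerreGAGA1956, §2 n°5 Prop. 2] [cite: VoisinHodgeI2002, §6.1.3 Prop. 6.11] -/
theorem periodDeficiency_hodgeModelsExist_proof : PeriodDeficiency.HodgeModelsExist := by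
  unfold PeriodDeficiency.HodgeModelsExist
  intro n X hX
  exact Literature.AlgebraicGeometry.HodgeTheory.nonempty_hodgeModel_holds hX

/-- **`Assembly` from the two open support items** of route `PeriodDeficiency`:
`ClassicalGeometricVHS → GenericityReduction → Assembly`.  Pure logic: `GenericityReduction` is the
chain `ClassicalGeometricVHS → HGQ → HC(ℚ̄) → HodgeModelsExist → HodgeConjecture`, and
`HodgeModelsExist` is `periodDeficiency_hodgeModelsExist_proof`.  Hence item
stmt-HodgeConjecture-13787 closes the moment stmt-HodgeConjecture-11597 and
stmt-HodgeConjecture-11598 land (apply this lemma to their `_holds` links). -/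
theorem periodDeficiency_assembly_of_supports (hC : PeriodDeficiency.ClassicalGeometricVHS)
    (hG : PeriodDeficiency.GenericityReduction) : PeriodDeficiency.Assembly := by
  unfold PeriodDeficiency.Assembly
  intro h₁ h₂
  exact hG hC h₁ h₂ periodDeficiency_hodgeModelsExist_proof

/-- **`Assembly` is a consequence of the Hodge conjecture itself** (`HodgeConjecture → Assembly`,
the conclusion of an implication implies the implication): the item is consistent with the summit
statement and can only be refuted by refuting `HodgeConjecture`. -/
theorem periodDeficiency_assembly_of_hodgeConjecture (h : _root_.HodgeConjecture) :
    PeriodDeficiency.Assembly := by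
  unfold PeriodDeficiency.Assembly
  exact fun _ _ => h

end Summit.HodgeConjecture.HodgeConjecture.Theorems

end
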